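import Literature.Geometry.Riemannian.SphericalCylinderEntropy
import Mathlib.MeasureTheory.Measure.HasOuterApproxClosed
import Mathlib.MeasureTheory.Measure.Prod
import Mathlib.MeasureTheory.Integral.Prod
import Mathlib.MeasureTheory.Integral.BoundedContinuousFunction
import HarnessLib

/-!
# Route `CylinderEntropy`, crux `CylinderRungTwo` (stmt-SmoothPoincare4-7631), line `killing-flux`:
# the product identification (registered helper `helper_productIdentification`, step S7a of the
# area-quantization plan)

Let `μ` be a finite Borel measure on `ℝ⁶` and write `π z = (z', z₅)` with `z' = truncL z ∈ ℝ⁵` the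
first five coordinates.  Suppose `μ` is *uniform in the `S⁴` factor against continuous test
functions*: for all continuous `Φ : ℝ → ℝ` and `g : ℝ⁵ → ℝ`,

  `∫ Φ(z₅) g(z') dμ(z) = μH⁴(S⁴)⁻¹ · (∫_{S⁴} g dμH⁴) · ∫ Φ(z₅) dμ(z)`.

Then the push-forward `π_* μ` on `ℝ⁵ × ℝ` IS the product `U ⊗ σ` of the normalised surface measure
`U = μH⁴(S⁴)⁻¹ · μH⁴⌊S⁴` with the height marginal `σ = (z ↦ z₅)_* μ`.

Proof.  Both `π_* μ` and `U ⊗ σ` are finite Borel measures on `ℝ⁵ × ℝ`, and by the hypothesis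
(change of variables, Fubini for `U ⊗ σ`) they have the same integrals against all products
`g(v) Φ(s)` of continuous (bounded) functions.  Two finite Borel measures `m, m'` on a product
`α × β` of metrisable spaces with this property coincide (`ext_of_forall_lintegral_mul_eq`):
* for a fixed bounded continuous `f ≥ 0` on `α`, the `f`-weighted second marginals
  `B ↦ ∫_{α × B} f(p.1) dm` and `… dm'` are finite measures on `β` with equal integrals against all
  bounded continuous `g ≥ 0`, hence equal (`ext_of_forall_lintegral_eq_of_IsFiniteMeasure` of
  Mathlib, i.e. closed sets are approximated from outside by thickened indicators);
* so for a fixed Borel `B ⊆ β` the first marginals of `m⌊(α × B)` and `m'⌊(α × B)` have equal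
  integrals against all bounded continuous `f ≥ 0`, hence are equal;
* i.e. `m (A × B) = m' (A × B)` for all Borel rectangles, and finite measures on a product agreeing
  on measurable rectangles are equal (`Measure.ext_prod`, a π-λ argument).

Everything here is PROVED (no `sorry`, no new definitions, no named facts); the carrier hypothesis
`μ(ℝ⁶ ∖ N) = 0` of the registered signature is not even used.

References: P. Billingsley, *Convergence of Probability Measures* (2nd ed., 1999), Thm 1.2–1.3
(a finite Borel measure on a metric space is determined by the integrals of bounded continuous
functions; separating classes of rectangles).
-/

-- the prescribed namespace `Summit.SmoothPoincare4.SmoothPoincare4.…` repeats `SmoothPoincare4`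
set_option linter.dupNamespace false

noncomputable section

open MeasureTheory Set Filter BoundedContinuousFunction
open scoped ENNReal NNReal Topology BigOperators

namespace Summit.SmoothPoincare4.SmoothPoincare4.Cruxes.CylinderRungTwo.KillingFlux

open Literature.Geometry.Riemannian.SphericalCylinderEntropy (truncL truncL_apply
  hausdorffMeasure_sphere_four_pos hausdorffMeasure_sphere_four_lt_top)

/-! ## Finite measures on a product are determined by products of bounded continuous functions -/

section Abstract

variable {α β : Type*} [TopologicalSpace α] [MeasurableSpace α] [BorelSpace α]
  [TopologicalSpace β] [MeasurableSpace β] [BorelSpace β] [HasOuterApproxClosed β]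
  {m m' : Measure (α × β)}

/-- If two measures `m, m'` on `α × β` (`m` finite) integrate all products `f(p.1) g(p.2)` of
bounded continuous non-negative functions to the same value, then for every such `f` the
`f`-weighted second marginals `B ↦ ∫_{α × B} f(p.1) dm` and `B ↦ ∫_{α × B} f(p.1) dm'` coincide.
[folklore] -/
theorem snd_withDensity_eq_of_forall_lintegral_mul_eq [IsFiniteMeasure m]
    (h : ∀ (f : α →ᵇ ℝ≥0) (g : β →ᵇ ℝ≥0),
      ∫⁻ p, (f p.1 : ℝ≥0∞) * g p.2 ∂m = ∫⁻ p, (f p.1 : ℝ≥0∞) * g p.2 ∂m')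
    (f : α →ᵇ ℝ≥0) :
    (m.withDensity fun p => (f p.1 : ℝ≥0∞)).snd =
      (m'.withDensity fun p => (f p.1 : ℝ≥0∞)).snd := by
  have hfm : Measurable fun p : α × β => (f p.1 : ℝ≥0∞) :=
    measurable_coe_nnreal_ennreal.comp (f.continuous.measurable.comp measurable_fst)
  haveI : IsFiniteMeasure (m.withDensity fun p => (f p.1 : ℝ≥0∞)) :=
    isFiniteMeasure_withDensity (IsFiniteMeasure.lintegral_lt_top_of_bounded_to_ennreal m
      ⟨nndist f 0, fun p => ENNReal.coe_le_coe.2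
        (BoundedContinuousFunction.NNReal.upper_bound f p.1)⟩).ne
  refine ext_of_forall_lintegral_eq_of_IsFiniteMeasure fun g => ?_
  have hgm : Measurable fun b : β => (g b : ℝ≥0∞) :=
    measurable_coe_nnreal_ennreal.comp g.continuous.measurable
  have hgm2 : Measurable fun p : α × β => (g p.2 : ℝ≥0∞) := hgm.comp measurable_snd
  rw [Measure.snd, Measure.snd, lintegral_map hgm measurable_snd, lintegral_map hgm measurable_snd,
    lintegral_withDensity_eq_lintegral_mul _ hfm hgm2,
    lintegral_withDensity_eq_lintegral_mul _ hfm hgm2]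
  exact h f g

/-- **Uniqueness from products of test functions.** Two measures `m, m'` on the product `α × β` of
two metrisable (more generally `HasOuterApproxClosed`) Borel spaces, `m` finite, which integrate
all products `f(p.1) g(p.2)` of bounded continuous non-negative functions to the same value, are
equal: the weighted second marginals agree (previous lemma), hence the first marginals of the
restrictions to every horizontal strip `α × B` agree, i.e. `m = m'` on measurable rectangles, and
`Measure.ext_prod` concludes. [folklore] -/
theorem ext_of_forall_lintegral_mul_eq [HasOuterApproxClosed α] [IsFiniteMeasure m]
    (h : ∀ (f : α →ᵇ ℝ≥0) (g : β →ᵇ ℝ≥0),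
      ∫⁻ p, (f p.1 : ℝ≥0∞) * g p.2 ∂m = ∫⁻ p, (f p.1 : ℝ≥0∞) * g p.2 ∂m') :
    m = m' := by
  refine Measure.ext_prod fun {s} {t} hs ht => ?_
  -- the first marginals of the restrictions to the strip `α × t` agree
  have key : (m.restrict (Prod.snd ⁻¹' t)).fst = (m'.restrict (Prod.snd ⁻¹' t)).fst := by
    refine ext_of_forall_lintegral_eq_of_IsFiniteMeasure fun f => ?_
    have hfm : Measurable fun a : α => (f a : ℝ≥0∞) :=
      measurable_coe_nnreal_ennreal.comp f.continuous.measurable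
    rw [Measure.fst, Measure.fst, lintegral_map hfm measurable_fst,
      lintegral_map hfm measurable_fst]
    -- `∫⁻_{α × t} f(p.1) dm = ∫⁻_{α × t} f(p.1) dm'` from the weighted second marginals
    have h2 := congrArg (fun ρ : Measure β => ρ t)
      (snd_withDensity_eq_of_forall_lintegral_mul_eq h f)
    rwa [Measure.snd_apply ht, Measure.snd_apply ht, withDensity_apply _ (measurable_snd ht),
      withDensity_apply _ (measurable_snd ht)] at h2
  have key' := congrArg (fun ρ : Measure α => ρ s) key
  rw [Measure.fst_apply hs, Measure.fst_apply hs, Measure.restrict_apply (measurable_fst hs),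
    Measure.restrict_apply (measurable_fst hs)] at key'
  exact key'

end Abstract

/-! ## The concrete identification on `S⁴ × ℝ ⊂ ℝ⁵ × ℝ` -/

section Concrete

/-- The normalised surface measure `μH⁴(S⁴)⁻¹ · μH⁴⌊S⁴` of `S⁴ ⊂ ℝ⁵` is a finite measure
(`0 < μH⁴(S⁴) < ⊤`). [folklore] -/
theorem isFiniteMeasure_uniformSphere :
    IsFiniteMeasure ((μH[4] (Metric.sphere (0 : EuclideanSpace ℝ (Fin 5)) 1))⁻¹ •
      (μH[4] : Measure (EuclideanSpace ℝ (Fin 5))).restrict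
        (Metric.sphere (0 : EuclideanSpace ℝ (Fin 5)) 1)) := by
  refine ⟨?_⟩
  rw [Measure.smul_apply, Measure.restrict_apply MeasurableSet.univ, Set.univ_inter, smul_eq_mul]
  exact ENNReal.mul_lt_top (ENNReal.inv_lt_top.2 hausdorffMeasure_sphere_four_pos)
    hausdorffMeasure_sphere_four_lt_top

variable (μ : Measure (EuclideanSpace ℝ (Fin 6))) [IsFiniteMeasure μ]
  (hyp : ∀ Φ : ℝ → ℝ, Continuous Φ → ∀ g : EuclideanSpace ℝ (Fin 5) → ℝ, Continuous g →
    ∫ z, Φ (z 5) * g (truncL z) ∂μ =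
      ((μH[4] (Metric.sphere (0 : EuclideanSpace ℝ (Fin 5)) 1)).toReal)⁻¹ *
        (∫ y in Metric.sphere (0 : EuclideanSpace ℝ (Fin 5)) 1, g y
          ∂(μH[4] : Measure (EuclideanSpace ℝ (Fin 5)))) * ∫ z, Φ (z 5) ∂μ)
include hyp

/-- **Step 1 (test functions).** Under the uniformity hypothesis, `π_* μ` and `U ⊗ σ` integrate
every product `g(v) Φ(s)` of continuous functions to the same value: change of variables for
`π = (truncL, z₅)` on the left, Fubini (`integral_prod_mul`) and change of variables for `z ↦ z₅` on
the right. [folklore] -/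
theorem integral_mul_map_pair_eq_integral_mul_prod {g : EuclideanSpace ℝ (Fin 5) → ℝ}
    (hg : Continuous g) {Φ : ℝ → ℝ} (hΦ : Continuous Φ) :
    ∫ p, g p.1 * Φ p.2 ∂(Measure.map (fun z : EuclideanSpace ℝ (Fin 6) => (truncL z, z 5)) μ) =
      ∫ p, g p.1 * Φ p.2 ∂(((μH[4] (Metric.sphere (0 : EuclideanSpace ℝ (Fin 5)) 1))⁻¹ •
        (μH[4] : Measure (EuclideanSpace ℝ (Fin 5))).restrict
          (Metric.sphere (0 : EuclideanSpace ℝ (Fin 5)) 1)).prod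
        (Measure.map (fun z : EuclideanSpace ℝ (Fin 6) => z 5) μ)) := by
  have h5 : Continuous fun z : EuclideanSpace ℝ (Fin 6) => z 5 := by fun_prop
  have hπ : Continuous fun z : EuclideanSpace ℝ (Fin 6) => (truncL z, z 5) :=
    truncL.continuous.prodMk h5
  have hF : Continuous fun p : EuclideanSpace ℝ (Fin 5) × ℝ => g p.1 * Φ p.2 :=
    (hg.comp continuous_fst).mul (hΦ.comp continuous_snd)
  haveI := isFiniteMeasure_uniformSphere
  have lhs : ∫ p, g p.1 * Φ p.2
      ∂(Measure.map (fun z : EuclideanSpace ℝ (Fin 6) => (truncL z, z 5)) μ) =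
        ∫ z, Φ (z 5) * g (truncL z) ∂μ := by
    rw [integral_map hπ.aemeasurable hF.aestronglyMeasurable]
    exact integral_congr_ae (Eventually.of_forall fun z => mul_comm _ _)
  have rhs : ∫ p, g p.1 * Φ p.2
      ∂(((μH[4] (Metric.sphere (0 : EuclideanSpace ℝ (Fin 5)) 1))⁻¹ •
        (μH[4] : Measure (EuclideanSpace ℝ (Fin 5))).restrict
          (Metric.sphere (0 : EuclideanSpace ℝ (Fin 5)) 1)).prod
        (Measure.map (fun z : EuclideanSpace ℝ (Fin 6) => z 5) μ)) =
      ((μH[4] (Metric.sphere (0 : EuclideanSpace ℝ (Fin 5)) 1)).toReal)⁻¹ *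
        (∫ y in Metric.sphere (0 : EuclideanSpace ℝ (Fin 5)) 1, g y
          ∂(μH[4] : Measure (EuclideanSpace ℝ (Fin 5)))) * ∫ z, Φ (z 5) ∂μ := by
    rw [integral_prod_mul g Φ, integral_smul_measure,
      integral_map h5.aemeasurable hΦ.aestronglyMeasurable, smul_eq_mul, ENNReal.toReal_inv]
  rw [lhs, rhs]
  exact hyp Φ hΦ g hg

/-- Step 1 in Lebesgue-integral form, for bounded continuous `ℝ≥0`-valued test functions (the
products are bounded, hence integrable for the two finite measures). [folklore] -/
theorem lintegral_mul_map_pair_eq_lintegral_mul_prod (f : EuclideanSpace ℝ (Fin 5) →ᵇ ℝ≥0)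
    (g : ℝ →ᵇ ℝ≥0) :
    ∫⁻ p, (f p.1 : ℝ≥0∞) * g p.2
      ∂(Measure.map (fun z : EuclideanSpace ℝ (Fin 6) => (truncL z, z 5)) μ) =
      ∫⁻ p, (f p.1 : ℝ≥0∞) * g p.2
        ∂(((μH[4] (Metric.sphere (0 : EuclideanSpace ℝ (Fin 5)) 1))⁻¹ •
          (μH[4] : Measure (EuclideanSpace ℝ (Fin 5))).restrict
            (Metric.sphere (0 : EuclideanSpace ℝ (Fin 5)) 1)).prod
          (Measure.map (fun z : EuclideanSpace ℝ (Fin 6) => z 5) μ)) := by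
  haveI := isFiniteMeasure_uniformSphere
  have hFc : Continuous fun p : EuclideanSpace ℝ (Fin 5) × ℝ =>
      ((f p.1 : ℝ≥0) : ℝ) * ((g p.2 : ℝ≥0) : ℝ) := by
    fun_prop
  have key : ∀ (ρ : Measure (EuclideanSpace ℝ (Fin 5) × ℝ)) [IsFiniteMeasure ρ],
      ∫⁻ p, (f p.1 : ℝ≥0∞) * g p.2 ∂ρ = ENNReal.ofReal (∫ p, (f p.1 : ℝ) * g p.2 ∂ρ) := by
    intro ρ _
    have hint : Integrable (fun p : EuclideanSpace ℝ (Fin 5) × ℝ => ((f p.1 * g p.2 : ℝ≥0) : ℝ))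
        ρ := by
      refine Integrable.of_bound ?_ ((nndist f 0 : ℝ) * nndist g 0)
        (Eventually.of_forall fun p => ?_)
      · simp only [NNReal.coe_mul]
        exact hFc.aestronglyMeasurable
      · rw [NNReal.coe_mul, Real.norm_eq_abs, abs_of_nonneg (by positivity)]
        exact mul_le_mul
          (NNReal.coe_le_coe.2 (BoundedContinuousFunction.NNReal.upper_bound f p.1))
          (NNReal.coe_le_coe.2 (BoundedContinuousFunction.NNReal.upper_bound g p.2))
          (NNReal.coe_nonneg _) (NNReal.coe_nonneg _)
    have := lintegral_coe_eq_integral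
      (fun p : EuclideanSpace ℝ (Fin 5) × ℝ => f p.1 * g p.2) hint
    simpa only [ENNReal.coe_mul, NNReal.coe_mul] using this
  rw [key, key]
  exact congrArg ENNReal.ofReal (integral_mul_map_pair_eq_integral_mul_prod μ hyp
    (g := fun v => (f v : ℝ)) (Φ := fun s => (g s : ℝ)) (by fun_prop) (by fun_prop))

end Concrete

/-- **Registered helper `helper_productIdentification` of line `killing-flux` (step S7a of the
area-quantization plan).** A finite measure `μ` on `ℝ⁶`, carried by `N = S⁴ × ℝ`, which is uniform
in the `S⁴` factor against continuous test functions
(`∫ Φ(z₅) g(z') dμ = μH⁴(S⁴)⁻¹ (∫_{S⁴} g dμH⁴) ∫ Φ(z₅) dμ` for all continuous `Φ`, `g`), pushes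
forward under `z ↦ (z', z₅)` to the product of the normalised surface measure of `S⁴` with its
height marginal: `(truncL, z₅)_* μ = (μH⁴(S⁴)⁻¹ · μH⁴⌊S⁴) ⊗ (z₅)_* μ`. [folklore] -/
theorem helper_productIdentification : ∀ (μ : Measure (EuclideanSpace ℝ (Fin 6))) [IsFiniteMeasure μ], μ {z : EuclideanSpace ℝ (Fin 6) | ¬ (∑ i : Fin 5, z (Fin.castSucc i) ^ 2 = 1)} = 0 → (∀ Φ : ℝ → ℝ, Continuous Φ → ∀ g : EuclideanSpace ℝ (Fin 5) → ℝ, Continuous g → ∫ z, Φ (z 5) * g (Literature.Geometry.Riemannian.SphericalCylinderEntropy.truncL z) ∂μ = ((μH[4] (Metric.sphere (0 : EuclideanSpace ℝ (Fin 5)) 1)).toReal)⁻¹ * (∫ y in Metric.sphere (0 : EuclideanSpace ℝ (Fin 5)) 1, g y ∂(μH[4] : Measure (EuclideanSpace ℝ (Fin 5)))) * ∫ z, Φ (z 5) ∂μ) → Measure.map (fun z : EuclideanSpace ℝ (Fin 6) => (Literature.Geometry.Riemannian.SphericalCylinderEntropy.truncL z, z 5)) μ = ((μH[4] (Metric.sphere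 (0 : EuclideanSpace ℝ (Fin 5)) 1))⁻¹ • (μH[4] : Measure (EuclideanSpace ℝ (Fin 5))).restrict (Metric.sphere (0 : EuclideanSpace ℝ (Fin 5)) 1)).prod (Measure.map (fun z : EuclideanSpace ℝ (Fin 6) => z 5) μ) := by
  intro μ _ _ hyp
  exact ext_of_forall_lintegral_mul_eq (lintegral_mul_map_pair_eq_lintegral_mul_prod μ hyp)

end Summit.SmoothPoincare4.SmoothPoincare4.Cruxes.CylinderRungTwo.KillingFlux

end
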